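import Summits.BirchSwinnertonDyer.BirchSwinnertonDyer.Theorems.SignedLowerHalvesSmallImageLowerHalfBothSignsRttD2SpecialisationHKCyclic
import Summits.BirchSwinnertonDyer.BirchSwinnertonDyer.Theorems.SignedLowerHalvesSmallImageLowerHalfBothSignsRttD2SpecialisationCyclicZeta
import Summits.BirchSwinnertonDyer.BirchSwinnertonDyer.Theorems.SignedLowerHalvesSmallImageLowerHalfBothSignsRttD2DescentAlgebra
import Literature.NumberTheory.EllipticCurves.IwasawaAlgebraRankOneIdealProofs
import HarnessLib

/-!
# Route `SignedLowerHalves`, crux L `SmallImageLowerHalfBothSigns` (item stmt-BirchSwinnertonDyer-23599), line `rtt_w3` v13 — E2, row D2-b, ROAD D CLOSED ON THE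
# ALGEBRAIC SIDE when `H¹` is FREE OF RANK ONE (LEAD g9 ruling (3), 14:38:47Z): with `e : H1 ≃ₗ[R] R` and ONE auxiliary `𝔞` with `φ(N𝔞 − σ_𝔞) ∈ Λ_𝒪ˣ`,
# `D.Thm52Shape` + `f`-regularity give BOTH the defect `(H¹ ⧸ Z)[f] = 0` AND the cyclicity `Z̄ = R∙z`, hence the glue's `hK` with no further hypothesis

Width seat `bsd-line-slh-p3-w3` g19 under LEAD `cruxlead-stmt-BirchSwinnertonDyer-23599` g9; ROUTE-INDEPENDENT helper (`--supports stmt-BirchSwinnertonDyer-23599`);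
THEOREMS ONLY — no definition, no named fact, no instance, no `sorry`; closes nothing; BSD / E2 / crux L are proved for NO curve. Whether JLK's `H¹` IS free of rank
one over `Λ₂,𝒪` (print: `H⁰ = 0` + perfectness, JLK Lemma 4.3 / Fukaya–Kato 1.6.5) is a typed-fact question (row «D2-O-PERF») or stays the hypothesis `e`.

Notation of `…RttD2SpecialisationHK` (`R = 𝒪⟦T₂⟧⟦T₁⟧`, `f = C (X − C b)`, `φ`, clauses, `ι`).
* §1 (any `𝒪`): `isUnit_of_isUnit_map` (`𝒪` local: `φ r ∈ Λ_𝒪ˣ ⟹ r ∈ Rˣ`, since `ker φ = (f) ⊆ 𝔪_R`); `Z_eq_cyclic_of_isUnit` (`N𝔞 − σ_𝔞 ∈ Rˣ ⟹ D.Z = D.cyclic a`,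
  from `aZeta_indep`); `prime_C_X_sub_C_C` (`𝒪` a domain: `f` is prime, `R/(f) ≅ 𝒪⟦T⟧`); `torsionBy_quotient_span_eq_bot_of_linearEquiv` (`M ≃ R`, `f` prime,
  `f ∤ e w` ⟹ `(M ⧸ R∙w)[f] = 0` — the B1 lever of `…RttD2DescentAlgebra`); `not_dvd_of_thm52Shape` (`𝒪` a DVR: `Thm52Shape`, `hreg`, `H1 ≃ R`, `Z` cyclic ⟹
  `f ∤ e(_𝔞ζ)`, as `char(H1 ⧸ R∙ζ) = (e ζ) = char(H2) ⊄ (f)`).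
* §2 ★★ `torsionBy_quotient_Z_eq_bot_of_linearEquiv_of_isUnit` — THE DEFECT VANISHES: `Thm52Shape ∧ hreg ∧ (H1 ≃ₗ R) ∧ φ(nsub a) ∈ Λ_𝒪ˣ ⟹ torsionBy R (H1 ⧸ D.Z) f = ⊥`.
* §3 ★★★ `lambdaInvariant_quotient_span_zetaSp_le_of_thm52Shape_of_linearEquiv` — at `𝒪 = padicCoeffIntegers S`: the glue's
  `hK : lambdaInvariant p (Hsp ⧸ Λ_𝒪∙(zetaSp f D a)) ≤ lambdaInvariant p Ysp` from `Thm52Shape`, `hreg`, `e : H1 ≃ₗ[R] R`, `IsUnit (φ (D.nsub a))` and the structure pins only.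

References: [JohnsonLeungKings2011] Thm. 5.2, Cor. 5.3, Lemma 4.3/4.4, §5.2, §6.1; [Washington1997] §13.2; [BourbakiAC5to7] VII §4.5.
-/

set_option autoImplicit false
-- the Theorems namespace of this sub repeats the summit name by design (D-0017 nested layout)
set_option linter.dupNamespace false

noncomputable section

open scoped Pointwise nonZeroDivisors
open PowerSeries Literature.NumberTheory.Automorphic Literature.NumberTheory.EllipticCurves Literature.NumberTheory.EllipticCurves.Module
open Literature.NumberTheory.ComplexMultiplication.EllipticUnits.JohnsonLeungKings2011
open Summit.BirchSwinnertonDyer.BirchSwinnertonDyer.Theorems.SmallImageRttD2Spec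

namespace Summit.BirchSwinnertonDyer.BirchSwinnertonDyer.Theorems.SmallImageRttD2LamSpec

universe u v

/-! ## §1 Algebra: units lift along `φ`, cyclicity of `Z`, primality of `f`, the lever, `f ∤ e ζ` -/

section General

variable {A : Type u} [CommRing A] (b : A) (φ : PowerSeries (PowerSeries A) →+* PowerSeries A)
  (hC : ∀ a : A, φ (C (C a)) = C a) (hX : φ X = X) (hker : RingHom.ker φ = Ideal.span {C (X - C b)})

include hC hX hker in
/-- **Units lift along `φ`** (`𝒪` local, so `R = 𝒪⟦T₂⟧⟦T₁⟧` and `Λ_𝒪 = 𝒪⟦T⟧` are local and `ker φ = (f) ⊆ 𝔪_R`): `φ r ∈ Λ_𝒪ˣ ⟹ r ∈ Rˣ`. Used with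
`r = N𝔞 − σ_𝔞`. [folklore] -/
theorem isUnit_of_isUnit_map [IsLocalRing A] {r : PowerSeries (PowerSeries A)} (hr : IsUnit (φ r)) : IsUnit r := by
  obtain ⟨s, hs⟩ : ∃ s, φ s = ((hr.unit⁻¹ : (PowerSeries A)ˣ) : PowerSeries A) :=
    ⟨_, map_outer_eq_self_of_clauses' φ hC hX _⟩
  have h1 : φ (r * s) = 1 := by rw [map_mul, hs, IsUnit.mul_val_inv]
  have hmem : r * s - 1 ∈ RingHom.ker φ := by rw [RingHom.mem_ker, map_sub, h1, map_one, sub_self]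
  rw [hker, Ideal.mem_span_singleton] at hmem
  obtain ⟨c, hc⟩ := hmem
  -- `f` is not a unit (`φ f = 0`, `Λ_𝒪` non-trivial)
  have hf0 : φ (C (X - C b)) = 0 := by
    rw [← RingHom.mem_ker, hker]; exact Ideal.mem_span_singleton_self _
  have hfu : ¬ IsUnit (C (X - C b) * c : PowerSeries (PowerSeries A)) := fun hu ↦ by
    have h := (isUnit_of_mul_isUnit_left hu).map φ
    rw [hf0] at h
    exact not_isUnit_zero h
  have hrs : IsUnit (r * s) := by
    have h2 : r * s = 1 - (-(C (X - C b) * c)) := by rw [sub_neg_eq_add, ← hc]; ring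
    rw [h2]
    exact IsLocalRing.isUnit_one_sub_self_of_mem_nonunits _ (fun hu ↦ hfu ((IsUnit.neg_iff _).mp hu))
  exact isUnit_of_mul_isUnit_left hrs

omit hC hX hker in
/-- **`N𝔞 − σ_𝔞 ∈ Rˣ ⟹ 𝒥(ζ) = R∙_𝔞ζ`** (`D.Z = D.cyclic a`): `_𝔟ζ = (N𝔞 − σ_𝔞)⁻¹(N𝔟 − σ_𝔟)·_𝔞ζ` by `aZeta_indep`. [cite: JohnsonLeungKings2011, §5.2 (p0014:L100–105)] -/
theorem Z_eq_cyclic_of_isUnit {R : Type u} [CommRing R] {Aidx H0 H1 H2 : Type v} [AddCommGroup H0] [Module R H0] [AddCommGroup H1] [Module R H1]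
    [AddCommGroup H2] [Module R H2] (D : ZetaSkeleton R Aidx H0 H1 H2) (a : Aidx) (ha : IsUnit (D.nsub a)) : D.Z = D.cyclic a := by
  refine le_antisymm ?_ (D.cyclic_le_Z a)
  change Submodule.span R (Set.range D.aZeta) ≤ Submodule.span R {D.aZeta a}
  refine Submodule.span_le.mpr ?_
  rintro _ ⟨c, rfl⟩
  obtain ⟨w, hw⟩ := ha
  have h : D.aZeta c = ((w⁻¹ : Rˣ) : R) • (D.nsub c • D.aZeta a) := by
    rw [← D.aZeta_indep c a, ← hw, ← mul_smul, Units.inv_mul, one_smul]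
  rw [SetLike.mem_coe, h]
  exact Submodule.smul_mem _ _ (Submodule.smul_mem _ _ (Submodule.mem_span_singleton_self _))

include hker in
/-- **`f = C (X − C b)` is prime** (`𝒪` a domain): `(f) = ker φ` is a prime ideal as `R/(f) ≅ 𝒪⟦T⟧` is a domain. [folklore] -/
theorem prime_C_X_sub_C_C [IsDomain A] : Prime (C (X - C b) : PowerSeries (PowerSeries A)) := by
  have hP : (Ideal.span {(C (X - C b) : PowerSeries (PowerSeries A))}).IsPrime := hker ▸ RingHom.ker_isPrime φ
  exact (Ideal.span_singleton_prime (C_X_sub_C_C_ne_zero b)).mp hP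

omit hC hX hker in
/-- **The B1 lever for a free rank-one module:** `R` a domain, `f` prime, `e : M ≃ₗ[R] R`, `f ∤ e w` ⟹ `(M ⧸ R∙w)[f] = 0`
(`M` is `f`-torsion-free and `a·w ∈ fM ⟹ f ∣ a·e(w) ⟹ f ∣ a`). [cite: JohnsonLeungKings2011, Lemma 4.4] [cite: BourbakiAC5to7, VII §4.5] -/
theorem torsionBy_quotient_span_eq_bot_of_linearEquiv {R : Type u} [CommRing R] [IsDomain R] {M : Type v} [AddCommGroup M] [Module R M]
    (f : R) (hf : Prime f) (e : M ≃ₗ[R] R) (w : M) (hw : ¬ f ∣ e w) :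
    Submodule.torsionBy R (M ⧸ Submodule.span R {w}) f = ⊥ := by
  refine SmallImageRttD2Descent.torsionBy_quotient_span_eq_bot_of_lever f w (fun x hx ↦ ?_) (fun a y h ↦ ?_)
  · have h := congrArg e hx
    rw [map_smul, map_zero, smul_eq_mul] at h
    exact e.injective ((mul_eq_zero.mp h).resolve_left hf.ne_zero |>.trans (map_zero e).symm)
  · have h' := congrArg e h
    rw [map_smul, map_smul, smul_eq_mul, smul_eq_mul] at h'
    exact (hf.dvd_or_dvd ⟨e y, h'⟩).resolve_right hw

/-- **`f ∤ e(_𝔞ζ)` from `Thm52Shape` and `f`-regularity** (`𝒪` a DVR, `H1 ≃ₗ[R] R`, `D.Z = R∙_𝔞ζ`): `char(H1 ⧸ Z) = char(R ⧸ (e ζ)) = (e ζ)` equals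
`char(H2) ⊄ (f)`. (`e ζ ≠ 0` because `H1 ⧸ Z` is torsion while `R` is not.) [cite: JohnsonLeungKings2011, Thm. 5.2] [cite: Washington1997, §13.2] -/
theorem not_dvd_of_thm52Shape [IsDomain A] [IsDiscreteValuationRing A] {Aidx H0 H1 H2 : Type v} [AddCommGroup H0]
    [Module (PowerSeries (PowerSeries A)) H0] [AddCommGroup H1] [Module (PowerSeries (PowerSeries A)) H1] [AddCommGroup H2]
    [Module (PowerSeries (PowerSeries A)) H2] (D : ZetaSkeleton (PowerSeries (PowerSeries A)) Aidx H0 H1 H2) (h52 : D.Thm52Shape)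
    (hreg : ¬ charIdeal (PowerSeries (PowerSeries A)) H2 ≤ Ideal.span {(C (X - C b) : PowerSeries (PowerSeries A))})
    (e : H1 ≃ₗ[PowerSeries (PowerSeries A)] PowerSeries (PowerSeries A)) (a : Aidx) (hZ : D.Z = D.cyclic a) :
    ¬ (C (X - C b) : PowerSeries (PowerSeries A)) ∣ e (D.aZeta a) := by
  haveI : UniqueFactorizationMonoid (PowerSeries (PowerSeries A)) :=
    Literature.NumberTheory.IwasawaTheory.uniqueFactorizationMonoid_powerSeries_powerSeries A
  obtain ⟨⟨-, -, htors, -⟩, hchar⟩ := h52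
  -- `e ζ ≠ 0`
  have hw0 : e (D.aZeta a) ≠ 0 := by
    intro h0
    have hζ : D.aZeta a = 0 := e.injective (by rw [h0, map_zero])
    have hZ0 : D.Z = ⊥ := by
      rw [hZ]; change Submodule.span _ {D.aZeta a} = ⊥; rw [hζ, Submodule.span_singleton_eq_bot]
    obtain ⟨⟨t, ht⟩, htx⟩ := @htors (Submodule.Quotient.mk (e.symm 1))
    rw [Submonoid.mk_smul, ← Submodule.Quotient.mk_smul, Submodule.Quotient.mk_eq_zero, hZ0, Submodule.mem_bot,
      ← LinearEquiv.map_eq_zero_iff e, map_smul, LinearEquiv.apply_symm_apply, smul_eq_mul, mul_one] at htx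
    exact nonZeroDivisors.ne_zero ht htx
  -- `char(H1 ⧸ Z) = (e ζ)`
  have hmap : (Submodule.span (PowerSeries (PowerSeries A)) {D.aZeta a}).map
      (e : H1 →ₗ[PowerSeries (PowerSeries A)] PowerSeries (PowerSeries A)) = Ideal.span {e (D.aZeta a)} := by
    rw [Submodule.map_span, Set.image_singleton]; rfl
  have hcharZ : charIdeal (PowerSeries (PowerSeries A)) (H1 ⧸ D.Z) = Ideal.span {e (D.aZeta a)} := by
    rw [hZ]
    exact (charIdeal_eq_of_linearEquiv (Submodule.Quotient.equiv _ _ e hmap)).trans (charIdeal_quotient_span_singleton hw0)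
  intro hdvd
  apply hreg
  rw [← show charIdeal _ (H1 ⧸ D.Z) = charIdeal _ H2 from hchar, hcharZ, Ideal.span_singleton_le_span_singleton]
  exact hdvd

/-! ## §2 The defect vanishes for `H¹` free of rank one -/

include hC hX hker in
/-- ★★ **The defect `(H¹ ⧸ 𝒥(ζ))[f]` VANISHES when `H¹` is free of rank one** (`𝒪` a DVR): `D.Thm52Shape`, `f`-regularity `¬ char(H2) ≤ (f)`,
`e : H1 ≃ₗ[R] R` and one auxiliary `𝔞` with `φ (N𝔞 − σ_𝔞) ∈ Λ_𝒪ˣ` ⟹ `torsionBy R (H1 ⧸ D.Z) f = ⊥`. (Units lift ⟹ `Z = R∙_𝔞ζ`; `char(H1⧸Z) = (eζ) = char(H2) ⊄ (f)`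
⟹ `f ∤ eζ`; `f` prime ⟹ the lever.) [cite: JohnsonLeungKings2011, Thm. 5.2, Lemma 4.4, §5.2] -/
theorem torsionBy_quotient_Z_eq_bot_of_linearEquiv_of_isUnit [IsDomain A] [IsDiscreteValuationRing A] {Aidx H0 H1 H2 : Type v} [AddCommGroup H0]
    [Module (PowerSeries (PowerSeries A)) H0] [AddCommGroup H1] [Module (PowerSeries (PowerSeries A)) H1] [AddCommGroup H2]
    [Module (PowerSeries (PowerSeries A)) H2] (D : ZetaSkeleton (PowerSeries (PowerSeries A)) Aidx H0 H1 H2) (h52 : D.Thm52Shape)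
    (hreg : ¬ charIdeal (PowerSeries (PowerSeries A)) H2 ≤ Ideal.span {(C (X - C b) : PowerSeries (PowerSeries A))})
    (e : H1 ≃ₗ[PowerSeries (PowerSeries A)] PowerSeries (PowerSeries A)) (a : Aidx) (ha : IsUnit (φ (D.nsub a))) :
    Submodule.torsionBy (PowerSeries (PowerSeries A)) (H1 ⧸ D.Z) (C (X - C b)) = ⊥ := by
  have hZ : D.Z = D.cyclic a := Z_eq_cyclic_of_isUnit D a (isUnit_of_isUnit_map b φ hC hX hker ha)
  have hnd := not_dvd_of_thm52Shape b D h52 hreg e a hZ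
  rw [hZ]
  exact torsionBy_quotient_span_eq_bot_of_linearEquiv _ (prime_C_X_sub_C_C b φ hker) e _ hnd

end General

/-! ## §3 The glue's `hK` at `𝒪 = padicCoeffIntegers S` from `Thm52Shape` + `H¹ ≃ R` + one good `𝔞` -/

variable (p : ℕ) [Fact p.Prime] (S : Set (PadicAlgCl p)) [FiniteDimensional ℚ_[p] (padicCoeffField S)]
  (b : padicCoeffIntegers S) (φ : PowerSeries (IwasawaAlgebraO S) →+* IwasawaAlgebraO S)
  (hφf : φ (C (X - C b)) = 0) (hC : ∀ a : padicCoeffIntegers S, φ (C (C a)) = C a) (hX : φ X = X)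
  (hker : RingHom.ker φ = Ideal.span {C (X - C b)})

include hφf hC hX hker in
/-- ★★★ **Road D, algebraic side closed for `H¹` free of rank one.** `𝒪 = padicCoeffIntegers S`, `R = 𝒪⟦T₂⟧⟦T₁⟧`, `f = C (X − C b)`, `φ` with the
inner-evaluation clauses. Let `D : ZetaSkeleton R Aidx H0 H1 H2` (`H1`, `H2` f.g.) satisfy `D.Thm52Shape` and `f`-regularity `¬ char_R(H2) ≤ (f)`, let
`e : H1 ≃ₗ[R] R` (H¹ free of rank one) and let `𝔞` be an auxiliary index with `φ (D.nsub a) ∈ Λ_𝒪ˣ`. With `Hsp = QuotSMulTop f H1` carrying any `ι`-pinned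
`Λ_𝒪`-structure, the glue's `[Algebra Λ Λ_𝒪]` (`halg`), `[Module Λ Hsp]`, `[IsScalarTower Λ Λ_𝒪 Hsp]`, and `QuotSMulTop f H2` a `Λ`-structure pinned to
`ι ∘ iwasawaToIwasawaO S`: `lambdaInvariant p (Hsp ⧸ Λ_𝒪∙(zetaSp f D a)) ≤ lambdaInvariant p (QuotSMulTop f H2)` — the binder `hK` of `charRoad_E2_of_parts`
(`H := Hsp`, `z := zetaSp f D a`, `Y := Ysp`), with NO defect / cyclicity hypothesis left. [cite: JohnsonLeungKings2011, Thm. 5.2, Cor. 5.3, Lemma 4.4, §5.2]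
[cite: Washington1997, §13.2] -/
theorem lambdaInvariant_quotient_span_zetaSp_le_of_thm52Shape_of_linearEquiv {Aidx H0 H1 H2 : Type v} [AddCommGroup H0]
    [Module (PowerSeries (IwasawaAlgebraO S)) H0] [AddCommGroup H1] [Module (PowerSeries (IwasawaAlgebraO S)) H1] [AddCommGroup H2]
    [Module (PowerSeries (IwasawaAlgebraO S)) H2] [Module.Finite (PowerSeries (IwasawaAlgebraO S)) H1]
    [Module.Finite (PowerSeries (IwasawaAlgebraO S)) H2]
    (D : ZetaSkeleton (PowerSeries (IwasawaAlgebraO S)) Aidx H0 H1 H2) (h52 : D.Thm52Shape)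
    (hreg : ¬ charIdeal (PowerSeries (IwasawaAlgebraO S)) H2 ≤ Ideal.span {(C (X - C b) : PowerSeries (IwasawaAlgebraO S))})
    (e : H1 ≃ₗ[PowerSeries (IwasawaAlgebraO S)] PowerSeries (IwasawaAlgebraO S)) (a : Aidx) (ha : IsUnit (φ (D.nsub a)))
    [Module (IwasawaAlgebraO S) (QuotSMulTop (C (X - C b) : PowerSeries (IwasawaAlgebraO S)) H1)]
    (hιH : ∀ (l : IwasawaAlgebraO S) (x : QuotSMulTop (C (X - C b) : PowerSeries (IwasawaAlgebraO S)) H1),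
      l • x = (PowerSeries.map (PowerSeries.C : padicCoeffIntegers S →+* IwasawaAlgebraO S) l) • x)
    [Algebra (IwasawaAlgebra p) (IwasawaAlgebraO S)]
    (halg : ∀ r : IwasawaAlgebra p, algebraMap (IwasawaAlgebra p) (IwasawaAlgebraO S) r = iwasawaToIwasawaO S r)
    [Module (IwasawaAlgebra p) (QuotSMulTop (C (X - C b) : PowerSeries (IwasawaAlgebraO S)) H1)]
    [IsScalarTower (IwasawaAlgebra p) (IwasawaAlgebraO S) (QuotSMulTop (C (X - C b) : PowerSeries (IwasawaAlgebraO S)) H1)]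
    [Module (IwasawaAlgebra p) (QuotSMulTop (C (X - C b) : PowerSeries (IwasawaAlgebraO S)) H2)]
    (hΛ2 : ∀ (r : IwasawaAlgebra p) (x : QuotSMulTop (C (X - C b) : PowerSeries (IwasawaAlgebraO S)) H2),
      r • x = (PowerSeries.map (PowerSeries.C : padicCoeffIntegers S →+* IwasawaAlgebraO S) (iwasawaToIwasawaO S r)) • x) :
    lambdaInvariant p (QuotSMulTop (C (X - C b) : PowerSeries (IwasawaAlgebraO S)) H1 ⧸
        Submodule.span (IwasawaAlgebraO S) {zetaSp (C (X - C b) : PowerSeries (IwasawaAlgebraO S)) D a}) ≤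
      lambdaInvariant p (QuotSMulTop (C (X - C b) : PowerSeries (IwasawaAlgebraO S)) H2) := by
  haveI : IsDiscreteValuationRing (padicCoeffIntegers S) := by
    rw [padicCoeffIntegers_eq_unitBall S]; exact LambdaLowerBoundO.isDiscreteValuationRing_unitBall p _
  exact lambdaInvariant_quotient_span_singleton_le_of_thm52Shape p S b φ hφf hC hX hker D h52 hreg
    (torsionBy_quotient_Z_eq_bot_of_linearEquiv_of_isUnit b φ hC hX hker D h52 hreg e a ha) hιH halg hΛ2 _
    (map_mkQ_Z_eq_span_zetaSp_of_isUnit b φ hC hX hker D a ha)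

end Summit.BirchSwinnertonDyer.BirchSwinnertonDyer.Theorems.SmallImageRttD2LamSpec

end
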